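import Summits.BirchSwinnertonDyer.BirchSwinnertonDyer.Theorems.AdditiveBranchIMCGordTwoRankZeroOffCaseOnePartnerLowerSUCore
import Literature.NumberTheory.EllipticCurves.NonvanishingTwistsPrescribedRamificationSimpleZero
import Literature.NumberTheory.EllipticCurves.BSDQuadraticDescent
import Literature.NumberTheory.EllipticCurves.BSDRootNumber
import Literature.NumberTheory.EllipticCurves.GrossZagierRationalPoint
import Literature.NumberTheory.EllipticCurves.LeadingTerm
import Literature.NumberTheory.EllipticCurves.Hsieh2014.AnticyclotomicPAdicLFunctionRamifiedSteinberg
import Literature.NumberTheory.EllipticCurves.LiuZhangZhang2018.PAdicWaldspurgerEllipticCurveAdditiveRamifiedSteinberg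
import Literature.NumberTheory.EllipticCurves.CaiShuTian2014.ExplicitGrossZagier
import Literature.NumberTheory.EllipticCurves.CaiShuTian2014.ExplicitGrossZagierRingClass
import Literature.NumberTheory.EllipticCurves.Voight2007.RingClassGenusField
import Literature.NumberTheory.EllipticCurves.ManinConstantSemistablePrimewise
import Literature.NumberTheory.EllipticCurves.Gross2004.RationalCharacterLSeries
import HarnessLib

/-!
# Registered stub `stub_partnerLowerSU` of line `three_field_road` v3 — PROVED, BY NAME AND SIGNATURE
# (crux `AdditiveBranchIMC.GordTwoRankZeroOffCaseOne`, stmt-BirchSwinnertonDyer-19357, route K1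
# `AdditiveBranchIMC`; stub-worker `bsd-line-addord-w3` under LEAD `cruxlead-stmt-BirchSwinnertonDyer-19357`;
# `--supports stmt-BirchSwinnertonDyer-19357`)

HONEST FRAMING. One theorem and one cite-only conjunction (a `def … : Prop`, nothing asserted); no
named fact; no `sorry`; BSD is proved for no curve by this file, and the crux item stays OPEN (six other
registered stubs of the line are untouched). The registered stub (skeleton v3, commit ec8e676431ae,
`ledger skeleton check` sha 0e644c0c8edb) — VERBATIM: FIELD 3 of the three-field road, the LOWER half
`MissingLowerBoundAt A p` (`ord_p #Ш_an(A) ≤ ord_p #Ш(A)`, `#Ш_an` rational) of the good-ordinary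
rank-zero partner `A`, at `p ≥ 5` with `ρ̄_{A,p}` onto and a multiplicative prime `ℓ ≠ p` at which
`ρ̄_{A,p}` is ramified (`p ∤ v_ℓ(Δ_min)`), from the line's cite-only conjunction `PrintedFactsR0`.

PROOF. The core file `AdditiveBranchIMCGordTwoRankZeroOffCaseOnePartnerLowerSUCore.lean`
(`missingLowerBoundAt_rankZero_of_S30`: Skinner–Urban 2014 Thm. 2 (a) = bsd.S30
`padicValRat_bsd_rank_zero`, modularity `hasEntireLFunction_rat`, Gross–Zagier–Kolyvagin
`rank_eq_analyticRank_of_analyticRank_le_one` ⟹ `BSDp A p` by `Rank1Residual.bsdp_rankZero_of_S30`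
⟹ `MissingPPartAt` ⟹ `MissingLowerBoundAt` by the typed bookkeeping) applied to the conjuncts 8, 3, 4
of `PrintedFactsR0`; `5 ≤ p` is only used as `3 ≤ p`.

WHY A `def` HERE. The stub is registered with the header `PrintedFactsR0 → ∀ (A …) …, … →
MissingLowerBoundAt A p`, where `PrintedFactsR0` is the LINE's cite-only conjunction declared in the
skeleton `Cruxes/GordTwoRankZeroOffCaseOne/Lines/three_field_road.lean` — a module outside the Theorems
import fence. To state the stub BY NAME AND SIGNATURE the conjunction is REPEATED VERBATIM below (same
fifteen conjuncts, same order, same spelling); the two constants are definitionally equal, so the LEAD's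
composition can discharge this file's hypothesis with its own `stub_printedFactsR0` (or call the core
theorem on the components). Nothing is asserted by the `def`; it is line vocabulary, not a Literature
fact and not an obligation.

References (locators only): [cite: SkinnerUrban2014, Thm. 2 (a) (p. 3) = Thm. 3.6.11 (a) (p. 46)]
[cite: Miller2011LMS, Def. 1.1 (arXiv:1010.2431 p. 3)]. presearch: n/a (assembly of tree theorems;
no new mathematics). Axioms: `propext`, `Classical.choice`, `Quot.sound`.
-/

set_option autoImplicit false
-- D-0017: single-problem summit, so `Summit.BirchSwinnertonDyer.BirchSwinnertonDyer.…` repeats a namespace BY DESIGN.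
set_option linter.dupNamespace false

noncomputable section

open scoped Classical

namespace Summit.BirchSwinnertonDyer.BirchSwinnertonDyer.Theorems.AdditiveBranchIMCThreeFieldRoad

open NumberField IsDedekindDomain
open WeierstrassCurve Literature.NumberTheory.EllipticCurves
  Literature.NumberTheory.EllipticCurves.ModularForms
  Literature.NumberTheory.EllipticCurves.Rank1Residual
  Literature.NumberTheory.EllipticCurves.Rank1Residual.Typed
open Field

/-- The printed theorems the three-field road consumes BY NAME — cite-only conjunction, VERBATIM the
skeleton's `PrintedFactsR0` (line `three_field_road` v3, `Cruxes/GordTwoRankZeroOffCaseOne/Lines/`):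
F6 (Friedberg–Hoffstein second alternative / Bump–Friedberg–Hoffstein simple-zero twist with prescribed
local behaviour); the parity fact; entire continuation; GZK over `ℚ`; Cassels' isogeny invariance; a
modular parametrisation; Gross–Zagier I.(7.3); Skinner–Urban 2014 Thm 2 (a) (`padicValRat_bsd_rank_zero`);
Cai–Shu–Tian 2014 Thm 1.1 (trivial and ring class character); Gross 2004 §2; Voight 2007 Prop. 3.8;
Mazur 1978 Cor. 4.1; Hsieh 2014 Thm B; Liu–Zhang–Zhang 2018 Thm 1.5.1+1.5.3. Line vocabulary repeated so
that the registered stub can be stated by name and signature under the Theorems import fence; NOTHING IS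
ASSERTED (each conjunct is an existing tree `Prop`, cited where it is declared). -/
def PrintedFactsR0 : Prop :=
  friedbergHoffstein_exists_twist_simpleZero_ramifiedAt_splitAt ∧
    (∀ W : WeierstrassCurve ℚ,
      Literature.NumberTheory.EllipticCurves.even_analyticRank_iff_rootNumber_eq_one W) ∧
    WeierstrassCurve.hasEntireLFunction_rat ∧
    Literature.NumberTheory.EllipticCurves.rank_eq_analyticRank_of_analyticRank_le_one ∧
    WeierstrassCurve.bsdRHS_eq_of_isIsogenous ∧
    Literature.NumberTheory.EllipticCurves.ModularForms.nonempty_modularParametrizationData ∧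
    Literature.NumberTheory.EllipticCurves.GrossZagier1986_thm_I_7_3 ∧
    Literature.NumberTheory.EllipticCurves.padicValRat_bsd_rank_zero ∧
    CaiShuTian2014.thm11_trivialChar ∧
    CaiShuTian2014.thm11_ringClassChar ∧
    Gross2004.rankinLSeries_eq_mul_quadraticTwist ∧
    Voight2007.prop38_sqrt_mem_ringClassField_iff ∧
    mazur_not_dvd_maninConstant_of_odd ∧
    Hsieh2014.thmB_exists_isHsiehLFunction_coeff_norm_eq_one_unrPeriod_ramifiedSteinberg ∧
    LiuZhangZhang2018.thm151_thm153_modularCurve_heegnerVector_additive_ramifiedSteinberg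

/-- Unfolding of `PrintedFactsR0` (by definition): the three conjuncts the partner's lower half uses —
modularity (3rd), GZK (4th), bsd.S30 (8th) — are projections of it. [folklore] -/
theorem PrintedFactsR0.s30 (h : PrintedFactsR0) :
    WeierstrassCurve.hasEntireLFunction_rat ∧
      Literature.NumberTheory.EllipticCurves.rank_eq_analyticRank_of_analyticRank_le_one ∧
      Literature.NumberTheory.EllipticCurves.padicValRat_bsd_rank_zero :=
  ⟨h.2.2.1, h.2.2.2.1, h.2.2.2.2.2.2.2.1⟩

/-- **Registered stub `stub_partnerLowerSU` of line `three_field_road` v3** (crux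
`GordTwoRankZeroOffCaseOne`, stmt-BirchSwinnertonDyer-19357), BY NAME AND SIGNATURE — FIELD 3: the
LOWER half of the good-ordinary rank-zero partner is Skinner–Urban 2014 Thm 2 (a) BY NAME
(`padicValRat_bsd_rank_zero` of `PrintedFactsR0`: `p ≥ 3`, good ordinary, `E[p]` irreducible (from
`Surj`), (ram), `L(A,1) ≠ 0` (from `r_an = 0` and `hasEntireLFunction_rat`), `ρ̄` onto, `Ш(A)` finite
(GZK)) + the `Ш_an` bookkeeping `shaAn A = L(A,1)·#tors² / (Ω_A ∏ c_ℓ)` ⟹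
`ord_p #Ш_an(A) = ord_p #Ш(A)`, in particular `≤`; here: the core theorem
`missingLowerBoundAt_rankZero_of_S30` on the conjuncts 8, 3, 4 of `PrintedFactsR0` (`5 ≤ p` used as
`3 ≤ p`). [cite: SkinnerUrban2014, Thm. 2 (a) (p. 3)] [cite: Miller2011LMS, Def. 1.1] -/
theorem stub_partnerLowerSU : PrintedFactsR0 →
    ∀ (A : WeierstrassCurve ℚ) [A.IsElliptic] [A.IsGloballyMinimal] (p : ℕ) [Fact p.Prime],
      5 ≤ p → A.analyticRank = 0 → GoodOrd A p → Surj A p →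
        (∃ ℓ : ℕ, ∃ _ : Fact ℓ.Prime, ℓ ≠ p ∧ A.HasMultiplicativeReductionAtPrime ℓ ∧
            ¬ p ∣ padicValInt ℓ A.minimalDiscriminantInt) →
        MissingLowerBoundAt A p := by
  intro hPF A _ _ p _ h5 hr hgo hsurj haux
  obtain ⟨hmod, hGZK, hS30⟩ := hPF.s30
  exact missingLowerBoundAt_rankZero_of_S30 hS30 hmod hGZK A p (by omega) hr hgo hsurj haux

end Summit.BirchSwinnertonDyer.BirchSwinnertonDyer.Theorems.AdditiveBranchIMCThreeFieldRoad

end
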